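import Mathlib
import Literature.Computability.AlgebraicComplexity.PermanentUniversality

/-!
# ABP = Hessenberg determinant (support for the construction item `TriangularClassManyRoots`)

Negative-side support lemma for crux `stmt-ValiantsHypothesis-18500` (`DerivedPencilRolle`), cdisprove seat,
2026-08-17: the universality half of `Cruxes/DerivedPencilRolle/Disproof.lean` §A.  (The tree already has the path sums
`Literature.Computability.AlgebraicComplexity.pathSum` with series/parallel composition and the PERMANENT version
`permanent_hess` (unit subdiagonal); here is the DETERMINANT version with `−1` subdiagonal, which is what turns an
ABP over lacunary monomials into a lacunary matrix pencil.)

An algebraic branching program on the linearly ordered nodes `0 < 1 < ⋯ < k` with edge labels `lab u v`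
(`u < v`, values in any commutative ring — for us constants or lacunary monomials `c·X^D` in `ℝ[X]`) computes
`P(k)`, where `P(0) = 1` and `P(v) = Σ_{u<v} P(u)·lab u v` (sum over increasing paths `0 → v` of the products
of labels).  The `k × k` HESSENBERG matrix `hessDet k lab` — row `p` = node `p`, column `q` = node `q+1`, entry
`lab p (q+1)` on and above the diagonal, `−1` on the subdiagonal, `0` below — has determinant exactly `P(k)`:
every path enters with sign `+` (`det_hessDet`).  Proof: the row vector `y_p = P(p)` satisfies
`y ᵥ* hessDet = P(k) • e_last` (telescoping through the `−1` subdiagonal); multiplying by the adjugate gives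
`det · y_0 = P(k) · adj_{last,0}`, and that cofactor is the determinant of an upper triangular matrix with `−1`
diagonal bordered by `e_last`, i.e. `1`.  [folklore: Valiant 1979; Mahajan–Vinay 1997]
-/

-- `Summit.ValiantsHypothesis.ValiantsHypothesis.…` repeats a component by the D-0017 layout
-- (single-conjunct summit), which the `dupNamespace` linter flags; the name is mandated.
set_option linter.dupNamespace false

namespace Summit.ValiantsHypothesis.ValiantsHypothesis.Theorems.DerivedPencilRolle.Negative

open scoped BigOperators Matrix
open Literature.Computability.AlgebraicComplexity (pathSum pathSum_zero pathSum_succ)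

variable {R : Type*} [CommRing R]

/-- The Hessenberg matrix of an ABP on nodes `0..k`: row `p` (node `p`), column `q` (node `q+1`). -/
def hessDet (k : ℕ) (lab : ℕ → ℕ → R) : Matrix (Fin k) (Fin k) R :=
  Matrix.of fun p q => if p.val ≤ q.val then lab p.val (q.val + 1) else if p.val = q.val + 1 then -1 else 0

/-- **Telescoping.** The row vector of path sums is a left null-vector of all but the last column:
`(P(p))_p ᵥ* hessDet = P(k+1) • e_last`. -/
theorem pathSum_vecMul_hessDet (k : ℕ) (lab : ℕ → ℕ → R) :
    Matrix.vecMul (fun p : Fin (k + 1) => pathSum lab p.val) (hessDet (k + 1) lab) =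
      pathSum lab (k + 1) • Pi.single (Fin.last k) (1 : R) := by
  ext q
  simp only [Matrix.vecMul, dotProduct, hessDet, Matrix.of_apply, Pi.smul_apply, smul_eq_mul]
  -- pass to a sum over `range (k+1)`
  rw [Fin.sum_univ_eq_sum_range
    (fun i => pathSum lab i * (if i ≤ q.val then lab i (q.val + 1) else if i = q.val + 1 then -1 else 0))
    (k + 1)]
  have hq : q.val + 1 ≤ k + 1 := q.isLt
  rw [Finset.range_eq_Ico, ← Finset.sum_Ico_consecutive _ (Nat.zero_le (q.val + 1)) hq]
  have hfirst : ∑ i ∈ Finset.Ico 0 (q.val + 1),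
      pathSum lab i * (if i ≤ q.val then lab i (q.val + 1) else if i = q.val + 1 then -1 else 0) =
      pathSum lab (q.val + 1) := by
    rw [pathSum_succ, Finset.range_eq_Ico]
    refine Finset.sum_congr rfl fun i hi => ?_
    rw [Finset.mem_Ico] at hi
    rw [if_pos (by omega)]
  rw [hfirst]
  by_cases hlast : q = Fin.last k
  · subst hlast
    simp
  · have hlt : q.val + 1 < k + 1 := by
      have : q.val < k := Fin.val_lt_last hlast
      omega
    rw [Finset.sum_eq_sum_Ico_succ_bot hlt, if_neg (by omega), if_pos rfl]
    have hrest : ∑ i ∈ Finset.Ico (q.val + 1 + 1) (k + 1),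
        pathSum lab i * (if i ≤ q.val then lab i (q.val + 1) else if i = q.val + 1 then -1 else 0) = 0 := by
      refine Finset.sum_eq_zero fun i hi => ?_
      rw [Finset.mem_Ico] at hi
      rw [if_neg (by omega), if_neg (by omega), mul_zero]
    rw [hrest, Pi.single_eq_of_ne hlast]
    ring

/-- The cofactor: `hessDet` with row `0` replaced by `e_last` has determinant `1`. -/
theorem det_updateRow_hessDet (k : ℕ) (lab : ℕ → ℕ → R) :
    ((hessDet (k + 1) lab).updateRow 0 (Pi.single (Fin.last k) (1 : R))).det = 1 := by
  rw [Matrix.det_succ_row_zero]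
  rw [Fintype.sum_eq_single (Fin.last k)]
  · simp only [Matrix.updateRow_self, Pi.single_eq_same, mul_one, Fin.val_last, Fin.succAbove_last]
    have htri : (((hessDet (k + 1) lab).updateRow 0 (Pi.single (Fin.last k) (1 : R))).submatrix Fin.succ
        Fin.castSucc).BlockTriangular id := by
      intro p q hpq
      simp only [id] at hpq
      rw [Matrix.submatrix_apply, Matrix.updateRow_ne (Fin.succ_ne_zero p)]
      simp only [hessDet, Matrix.of_apply, Fin.val_succ, Fin.val_castSucc]
      have : (q : ℕ) < p := hpq
      rw [if_neg (by omega), if_neg (by omega)]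
    rw [Matrix.det_of_upperTriangular htri]
    have hdiag : ∀ p : Fin k, (((hessDet (k + 1) lab).updateRow 0 (Pi.single (Fin.last k) (1 : R))).submatrix
        Fin.succ Fin.castSucc) p p = -1 := by
      intro p
      rw [Matrix.submatrix_apply, Matrix.updateRow_ne (Fin.succ_ne_zero p)]
      simp [hessDet, Matrix.of_apply, Fin.val_succ, Fin.val_castSucc]
    simp only [hdiag, Finset.prod_const, Finset.card_univ, Fintype.card_fin]
    rw [← mul_pow]
    simp
  · intro j hj
    rw [Matrix.updateRow_self, Pi.single_eq_of_ne hj]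
    simp

/-- **ABP = Hessenberg determinant**: `det (hessDet k lab) = P(k)`, every path counted with sign `+`. -/
theorem det_hessDet (k : ℕ) (lab : ℕ → ℕ → R) : (hessDet k lab).det = pathSum lab k := by
  cases k with
  | zero => rw [Matrix.det_isEmpty, pathSum_zero]
  | succ k =>
    set M := hessDet (k + 1) lab with hM
    set y : Fin (k + 1) → R := fun p => pathSum lab p.val with hy
    have h1 : Matrix.vecMul y M = pathSum lab (k + 1) • Pi.single (Fin.last k) (1 : R) :=
      pathSum_vecMul_hessDet k lab
    -- multiply by the adjugate on the right
    have h2 : Matrix.vecMul (Matrix.vecMul y M) M.adjugate = M.det • y := by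
      rw [Matrix.vecMul_vecMul, Matrix.mul_adjugate, Matrix.vecMul_smul, Matrix.vecMul_one]
    rw [h1, Matrix.smul_vecMul] at h2
    have h3 := congrFun h2 0
    simp only [Pi.smul_apply, smul_eq_mul] at h3
    have hrow : Matrix.vecMul (Pi.single (Fin.last k) (1 : R)) M.adjugate 0 = M.adjugate (Fin.last k) 0 := by
      simp [Matrix.vecMul, dotProduct, Pi.single_apply]
    rw [hrow, Matrix.adjugate_apply, det_updateRow_hessDet, mul_one] at h3
    have hy0 : y 0 = 1 := by simp [hy, pathSum_zero]
    rw [hy0, mul_one] at h3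
    exact h3.symm

end Summit.ValiantsHypothesis.ValiantsHypothesis.Theorems.DerivedPencilRolle.Negative
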